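import Mathlib
import Summits.MatrixMultiplication.MatrixMultiplication.Theorems.SubgroupIdentityDesigns.Negative.LevelOneFloor

/-!
# The `SL₂`-member law (all `p`): a TPP member containing `SL₂(𝔽_p)` kills the level-one witness

Route `LevelGradedCohnUmans`, crux `SubgroupIdentityDesigns`, the `(m,k) = (2,1)` cell.

If one member `H_j` of a subgroup-TPP triple `(H₁, H₂, H₃)` of `GL₂(𝔽_p)` contains `SL₂(𝔽_p)`
(every matrix of determinant `1`) — this is the case of a member with at least two Sylow
`p`-subgroups — then `H_j` is a union of determinant fibres, the other two members multiply
injectively into the coset space `GL₂ ⧸ H_j` (`card_mul_le_of_SL_member`), and therefore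
`|H₁|·|H₂|·|H₃| ≤ |GL₂(𝔽_p)| ≤ p⁴ ≤ 1 + p³ + (p-2)(p+1)³` (the level-one floor): the crux inequality
has NO level-one witness on such a triple, for every prime `p ≥ 3` and every `0 < ε ≤ 1` — without
any design hypothesis (`no_levelOne_witness_SL_member`).

This removes residual class (R3) ("a `p`-member containing `SL₂`") from the `(2,1)` cell; what is
left is: a single Borel-type `p`-member in the MIDDLE position, `p`-free triples, and `p = 3`.
VALUE = THEOREM (all `p`), NOT summit progress; the crux item stmt-MatrixMultiplication-14079 is
untouched and remains open.
-/

set_option linter.dupNamespace false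

noncomputable section

open scoped BigOperators Classical

open Summit.MatrixMultiplication.MatrixMultiplication.Theorems.LieRankDesigns.Negative
  (GLm Mat budget)

namespace Summit.MatrixMultiplication.MatrixMultiplication.Theorems.SubgroupIdentityDesigns.Negative

section SLMemberLaw

open Literature.Barriers.MatrixMultiplication (SubgroupTPP)

variable {p : ℕ} [hp : Fact p.Prime]

omit hp in
/-- A subgroup containing `SL₂` is a union of determinant fibres. -/
theorem mem_of_det_eq {K : Subgroup (GLm p 2)}
    (hK : ∀ g : GLm p 2, Matrix.GeneralLinearGroup.det g = 1 → g ∈ K) {g h : GLm p 2} (hh : h ∈ K)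
    (hdet : Matrix.GeneralLinearGroup.det g = Matrix.GeneralLinearGroup.det h) : g ∈ K := by
  have h1 : Matrix.GeneralLinearGroup.det (h⁻¹ * g) = 1 := by
    rw [map_mul, map_inv, hdet, inv_mul_cancel]
  have h2 := K.mul_mem hh (hK _ h1)
  rwa [mul_inv_cancel_left] at h2

/-- **Coset injection.**  If `K ⊇ SL₂(𝔽_p)` and `A, B` are subgroups such that `a·b ∈ K` (with
`a ∈ A`, `b ∈ B`) forces `a = b = 1`, then `(a, b) ↦ abK` is injective, so
`|A|·|B|·|K| ≤ |GL₂(𝔽_p)|`. -/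
theorem card_mul_le_of_SL_member {K A B : Subgroup (GLm p 2)}
    (hK : ∀ g : GLm p 2, Matrix.GeneralLinearGroup.det g = 1 → g ∈ K)
    (hAB : ∀ a ∈ A, ∀ b ∈ B, a * b ∈ K → a = 1 ∧ b = 1) :
    Nat.card A * Nat.card B * Nat.card K ≤ Nat.card (GLm p 2) := by
  let f : A × B → GLm p 2 ⧸ K := fun x => (((x.1 : GLm p 2) * x.2 : GLm p 2) : GLm p 2 ⧸ K)
  have hinj : Function.Injective f := by
    rintro ⟨a, b⟩ ⟨a', b'⟩ h
    have hmem : ((a : GLm p 2) * b)⁻¹ * ((a' : GLm p 2) * b') ∈ K := QuotientGroup.eq.mp h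
    have hdet : Matrix.GeneralLinearGroup.det
        ((a : GLm p 2)⁻¹ * (a' : GLm p 2) * ((b' : GLm p 2) * (b : GLm p 2)⁻¹)) =
        Matrix.GeneralLinearGroup.det
          (((a : GLm p 2) * (b : GLm p 2))⁻¹ * ((a' : GLm p 2) * (b' : GLm p 2))) := by
      simp only [map_mul, map_inv, mul_inv_rev]
      simp only [mul_assoc, mul_comm, mul_left_comm]
    have hmem' : (a : GLm p 2)⁻¹ * a' * ((b' : GLm p 2) * (b : GLm p 2)⁻¹) ∈ K :=
      mem_of_det_eq hK hmem hdet
    obtain ⟨h1, h2⟩ := hAB _ (A.mul_mem (A.inv_mem a.2) a'.2) _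
      (B.mul_mem b'.2 (B.inv_mem b.2)) hmem'
    rw [inv_mul_eq_one] at h1
    rw [mul_inv_eq_one] at h2
    exact Prod.ext (Subtype.ext h1) (Subtype.ext h2.symm)
  haveI : Finite (GLm p 2 ⧸ K) := Quotient.finite (QuotientGroup.leftRel K)
  have h := Nat.card_le_card_of_injective f hinj
  rw [Nat.card_prod] at h
  calc Nat.card A * Nat.card B * Nat.card K
      ≤ Nat.card (GLm p 2 ⧸ K) * Nat.card K := Nat.mul_le_mul_right _ h
    _ = Nat.card (GLm p 2) := (Subgroup.card_eq_card_quotient_mul_card_subgroup K).symm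

/-- `|GL₂(𝔽_p)| ≤ p⁴` (it injects into the `p⁴` matrices). -/
theorem card_GL_le : Nat.card (GLm p 2) ≤ p ^ 4 := by
  have h : Nat.card (GLm p 2) ≤ Nat.card (Mat p 2) :=
    Nat.card_le_card_of_injective (Units.val : GLm p 2 → Mat p 2) fun a b e => Units.ext e
  have hM : Nat.card (Mat p 2) = p ^ 4 := by
    show Nat.card (Fin 2 → Fin 2 → ZMod p) = p ^ 4
    rw [Nat.card_eq_fintype_card, Fintype.card_fun, Fintype.card_fun, ZMod.card, Fintype.card_fin]
    ring
  rw [← hM]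
  exact h

omit hp in
/-- Floor arithmetic: `p⁴ ≤ 1 + p³ + (p-2)(p+1)³` for `p ≥ 3` (margin `2p³ - 3p² - 5p - 1`). -/
theorem pow_four_le_floor (hp3 : 3 ≤ p) : p ^ 4 ≤ 1 + p ^ 3 + (p - 2) * (p + 1) ^ 3 := by
  obtain ⟨q, rfl⟩ : ∃ q, p = q + 3 := ⟨p - 3, by omega⟩
  have e2 : q + 3 - 2 = q + 1 := by omega
  rw [e2]
  exact Nat.le.intro (k := 2 * q ^ 3 + 15 * q ^ 2 + 31 * q + 11) (by ring)

/-- **TPP volume bound with an `SL₂`-member** (all `p`, no design needed): if some member of a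
subgroup-TPP triple contains `SL₂(𝔽_p)`, then `|H₁|·|H₂|·|H₃| ≤ |GL₂(𝔽_p)|`. -/
theorem volume_le_card_of_SL_member {H₁ H₂ H₃ : Subgroup (GLm p 2)} (htpp : SubgroupTPP H₁ H₂ H₃)
    (hSL : (∀ g : GLm p 2, Matrix.GeneralLinearGroup.det g = 1 → g ∈ H₁) ∨
      (∀ g : GLm p 2, Matrix.GeneralLinearGroup.det g = 1 → g ∈ H₂) ∨
      (∀ g : GLm p 2, Matrix.GeneralLinearGroup.det g = 1 → g ∈ H₃)) :
    Nat.card H₁ * Nat.card H₂ * Nat.card H₃ ≤ Nat.card (GLm p 2) := by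
  rcases hSL with h | h | h
  · -- pairs `(b, c)` with `bc ∈ H₁`: `a = (bc)⁻¹`
    have hAB : ∀ b ∈ H₂, ∀ c ∈ H₃, b * c ∈ H₁ → b = 1 ∧ c = 1 := fun b hb c hc hbc =>
      (htpp (b * c)⁻¹ (H₁.inv_mem hbc) b hb c hc (by group)).2
    have := card_mul_le_of_SL_member h hAB
    calc Nat.card H₁ * Nat.card H₂ * Nat.card H₃ = Nat.card H₂ * Nat.card H₃ * Nat.card H₁ := by
          ring
      _ ≤ Nat.card (GLm p 2) := this
  · -- pairs `(c, a)` with `ca ∈ H₂`: `b = (ca)⁻¹`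
    have hAB : ∀ c ∈ H₃, ∀ a ∈ H₁, c * a ∈ H₂ → c = 1 ∧ a = 1 := by
      intro c hc a ha hca
      have h3 := htpp a ha (c * a)⁻¹ (H₂.inv_mem hca) c hc (by group)
      exact ⟨h3.2.2, h3.1⟩
    have := card_mul_le_of_SL_member h hAB
    calc Nat.card H₁ * Nat.card H₂ * Nat.card H₃ = Nat.card H₃ * Nat.card H₁ * Nat.card H₂ := by
          ring
      _ ≤ Nat.card (GLm p 2) := this
  · -- pairs `(a, b)` with `ab ∈ H₃`: `c = (ab)⁻¹`
    have hAB : ∀ a ∈ H₁, ∀ b ∈ H₂, a * b ∈ H₃ → a = 1 ∧ b = 1 := fun a ha b hb hab =>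
      let h3 := htpp a ha b hb (a * b)⁻¹ (H₃.inv_mem hab) (by group)
      ⟨h3.1, h3.2.1⟩
    exact card_mul_le_of_SL_member h hAB

/-- **NO LEVEL-ONE WITNESS WITH AN `SL₂`-MEMBER** (all primes `p ≥ 3`, all `0 < ε ≤ 1`, no design
hypothesis): a subgroup-TPP triple one of whose members contains `SL₂(𝔽_p)` has
`|H₁||H₂||H₃| ≤ |GL₂(𝔽_p)| ≤ p⁴ ≤ 1 + p³ + (p-2)(p+1)³`, so the crux inequality fails. -/
theorem no_levelOne_witness_SL_member (hp3 : 3 ≤ p) {ε : ℝ} (hε : 0 < ε) (hε1 : ε ≤ 1)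
    {H₁ H₂ H₃ : Subgroup (GLm p 2)} (htpp : SubgroupTPP H₁ H₂ H₃)
    (hSL : (∀ g : GLm p 2, Matrix.GeneralLinearGroup.det g = 1 → g ∈ H₁) ∨
      (∀ g : GLm p 2, Matrix.GeneralLinearGroup.det g = 1 → g ∈ H₂) ∨
      (∀ g : GLm p 2, Matrix.GeneralLinearGroup.det g = 1 → g ∈ H₃)) :
    ¬ budget p 2 1 (2 + ε) <
      ((Nat.card H₁ * Nat.card H₂ * Nat.card H₃ : ℕ) : ℝ) ^ ((2 + ε) / 3) :=
  no_levelOne_witness_of_volume_le_nat (by linarith) hε1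
    ((volume_le_card_of_SL_member htpp hSL).trans (card_GL_le.trans (pow_four_le_floor hp3)))

end SLMemberLaw

end Summit.MatrixMultiplication.MatrixMultiplication.Theorems.SubgroupIdentityDesigns.Negative

end
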